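import Summits.Parity.BatemanHorn.Theses.RoughValueTransport
import Literature.NumberTheory.Sieve.BatemanHornProofs
import Summits.Parity.BatemanHorn.Theorems.RoughValueTransportRoughValueLawSieveBand
import Summits.Parity.BatemanHorn.Theorems.RoughValueTransportRoughValueLawOmegaFacts
import Summits.Parity.BatemanHorn.Theorems.RoughValueTransportRoughValueLawRatioAnchoring

/-!
# Line `increment-anchoring` for crux `RoughValueTransport.RoughValueLaw` (stmt-Parity-11390)

Crux (FIXED, concluded BY NAME by `RoughValueLaw_of` below, from `roughValueLaw_of_parts`):
for every Bateman–Horn system `f = (f₁,…,f_k)` and every `ω` satisfying the inline Buchstab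
predicate there is `A` with `Φ_f(x,u)·(log x)^k/x → A·(uω(u))^k` for every `u > 2`, where
`Φ_f(x,u) = #{1 ≤ n ≤ x : ∀ i, fᵢ(n) > 0 and no prime p < x^{deg fᵢ/u} divides fᵢ(n)}`.

## The line (idea card `Ideas/increment-anchoring.md`, merged per triage r1-1/2/3 with the RATIO
## form of `scale-free-normal-form`)

Subtract (here: DIVIDE OUT) the primes and anchor at infinity.  The crux has two cheap
degrees of freedom — the free constant `A` and the existence of every rung limit — and ONE
expensive content, the Buchstab SHAPE.  The two-sided fundamental lemma with Mertens for the
nested sub-systems (`stub_sieveAnchor`) pins the profile at infinite depth to `B(f)·U^k`,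
`B(f) = (C(f)/∏ deg fᵢ)·e^{−kγ}`; the inline predicate pins `ω → e^{−γ}` and
`uω(u) = 1 + log(u−1)` on `[2,3]` (`stub_omegaFacts`); a pure real-analysis squeeze
(`stub_ratioAnchoring`, the TRANSFER stub) then turns RATIO laws `Φ_f(x,u)/Φ_f(x,U) →
((uω(u))/(Uω(U)))^k` into rung limits with the FORCED constant `A = B(f)e^{kγ} = C(f)/∏ deg fᵢ`.
What is left of the crux is constant-free and existence-free and splits by depth at `u = 3`
(the `Ω ≤ 2` threshold, `Disproof.lean: eventually_cardFactors_le_two`):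

* `stub_deepRatioLaw`   — OPEN: ratios of jointly rough counts at depths `3 ≤ u < U`;
* `stub_shallowRatioLaw`— OPEN, ω-FREE: `Φ_f(x,u)/Φ_f(x,3) → ((1+log(u−1))/(1+log 2))^k`,
  `2 < u < 3` (for `k = 1`, `deg f = 2`: `Φ_f(x,3) − Φ_f(x,u)` counts `n²+1 = p₁p₂` with
  `x^{2/3} ≤ p₁ < x^{2/u}` — the `E₂` cells next to the prime threshold, i.e. the boundary regime
  of the crux; HARDEST).

Neither open stub implies the crux, the sibling crux `BalancedSemiprimeLayer`, or Bateman–Horn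
for `f` (card §Costume check); together with S1–S3 they give exactly the crux.

Composition `roughValueLaw_of_parts` (REAL proof, no sorry): for `u ≥ 3` it is S3 fed with S1, S2,
S4; for `2 < u < 3`, eventually `Φ(x,u)(log x)^k/x = [Φ(x,3)(log x)^k/x]·[Φ(x,u)/Φ(x,3)]`
(`Φ(x,3) ≠ 0` because its normalised limit `B e^{kγ}(1+log 2)^k` is positive), and
`B e^{kγ}(1+log 2)^k · ((1+log(u−1))/(1+log 2))^k = B e^{kγ}(uω(u))^k` by S2.

Every stub is stated over TREE VOCABULARY ONLY (no local `def`), so that each can be landed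
verbatim as `Summits/Parity/BatemanHorn/Theorems/RoughValueTransportRoughValueLaw<Stub>.lean`
with `--supports stmt-Parity-11390`.

Disproof.lean (cdisprove gen 1, cited through its evidence notes — the file is not mounted in a
planner jail and not yet published under `Cruxes/RoughValueLaw/`): the stub set honours
`roughValueLaw_false_without_nonAssociated` / `_false_without_irreducible` /
`_false_without_noFixedPrimeDivisor` at `stub_sieveAnchor` (sieve dimension `k` and the constant
`C(f) > 0` need distinct irreducible coordinates and `ω_f(p) < p`; `(X,X)` and `(X,X²)` break the
`U^k` normalisation) and at `stub_deepRatioLaw`/`stub_shallowRatioLaw` (the exponent `k` in the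
ratio targets is the number of DISTINCT coordinates); `_false_without_omegaInit` / `_omegaDDE` at
`stub_omegaFacts` (both clauses are what pins `ω`); `not_roughValueLawUniform`: every stub is
non-uniform in the depth (`∀ U, ∀ᶠ x`), never `∀ᶠ x, ∀ U`; instances `tendsto_ratio_X`,
`tendsto_ratio_X_explicit` (`→ 1 + log(u−1)` on `(2,3]`), `conclusion_twoXAddOne`,
`conclusion_fin_zero` are the `f = X`, `2X+1`, `k = 0` cases of S4/S5 (ratios of those limits).
No landed `Negative/` lemma exists for this crux (nothing to import).
-/

namespace Summit.Parity.BatemanHorn.Cruxes.RoughValueLaw.IncrementAnchoring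

open Filter Finset Polynomial
open scoped Topology BigOperators
open Literature.NumberTheory.Sieve
open Summit.Parity.BatemanHorn.Theses.RoughValueTransport (RoughValueLaw)

set_option linter.unusedVariables false

/-! ## The stubs (S1a, S1b, S2–S5)

Reshape 1 (line lead, 2026-08-16): the planner's single calibration stub `stub_sieveAnchor`
(two-sided fundamental lemma WITH Mertens, size L) is split at the skeleton level into its two
mathematically independent halves, each over tree vocabulary plus two INLINE expressions —

* the `p`-dependent class count
  `ω_f(x,U;p) = #{r mod p : ∃ i, p < x^{deg fᵢ/U} ∧ p ∣ fᵢ(r)}` and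
* the sieve product `V_f(x,U) = ∏_{p ≤ x} (1 − ω_f(x,U;p)/p)` (factors with `p ≥ max zᵢ` are `1`) —

namely `stub_sieveBand` (S1a: the SIEVE step, `Φ_f(x,U) = x·V_f(x,U)·(1 ± ε)` for `U ≥ U₁(ε)`,
eventually in `x`; fundamental lemma `SieveSequence.fundamental_lemma_uniform_holds` for the
sifting integer `N_x(n) = ∏_{p in a removed class} p`, template
`MoebiusShiftedPrimesSieveBound.lean` / `PairLinearFormSieve.lean`) and `stub_mertensAlongSystem`
(S1b: the MERTENS step, `V_f(x,U)·(log x)^k → C(f)e^{−kγ}U^k/∏ deg fᵢ` for every fixed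
`U ≥ ∑ deg fᵢ`; Mertens for the full system below `z_min` and for the SINGLE polynomials `fᵢ` on the
windows `[z_min, zᵢ)`, `1 − ∑ρᵢ/p = ∏(1 − ρᵢ/p)(1 + O(p⁻²))`).  The glue `sieveAnchor_of_parts`
(S1a → S1b → S1, real proof below) restores the planner's `stub_sieveAnchor` statement verbatim, so
`roughValueLaw_of_parts` is unchanged. -/

-- `stub_sieveBand`: LANDED (imported from the Theorems file; see module docstring).

/-- **S1b — `stub_mertensAlongSystem`: Mertens' theorem along a Bateman–Horn system with staggered
thresholds (PROVABLE NOW, size M/L).**  For every Bateman–Horn system `f` of `k` polynomials and every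
FIXED depth `U ≥ ∑ᵢ deg fᵢ` (so that `zᵢ = x^{deg fᵢ/U} ≤ x`), as `x → ∞`,
`V_f(x,U)·(log x)^k → (C(f)/∏ deg fᵢ)·e^{−kγ}·U^k`, with `V_f`, `ω_f` the inline expressions of
`stub_sieveBand` and `C(f) = batemanHornConst f`.
Why true / how to prove (no nested sub-systems needed): write `z_min = x^{d_min/U}`.  (i) Below
`z_min` every coordinate is sifted, `ω_f(x,U;p) = ω_f(p)` (`polyRootCountMod f p`), and
`(log z_min)^k ∏_{p < z_min}(1 − ω_f(p)/p) → C(f)e^{−kγ}` by the PROVED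
`IsBatemanHornSystem.hasBatemanHornConst_holds` (`∏_{p ≤ y}(1 − 1/p)^{−k}(1 − ω_f(p)/p) → C(f)`) times
Mertens' third theorem `Literature.NumberTheory.LFunctions.Mertens.tendsto_log_mul_prod_one_sub_inv_nat`.
(ii) For `p ≥ z_min → ∞` the root sets of distinct `fᵢ` are disjoint mod `p`
(`IsBatemanHornSystem.exists_polyRootCountMod_eq_sum`: beyond the resultant primes), so
`ω_f(x,U;p) = ∑_{i : p < zᵢ} ρᵢ(p)` and `1 − ∑ρᵢ/p = ∏ᵢ(1 − ρᵢ/p)·(1 + O((∑deg)²/p²))`, the correction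
product over `p ≥ z_min` tending to `1`; (iii) for each `i`, `∏_{z_min ≤ p < zᵢ}(1 − ρᵢ(p)/p) →
d_min/dᵢ` by Mertens for the SINGLE polynomial `fᵢ` (`![fᵢ]` is again a Bateman–Horn system:
irreducible, positive leading coefficient, `ρᵢ(p) ≤ ω_f(p) < p`; apply (i) with `k = 1` at `zᵢ` and at
`z_min`, ratio of logs `= d_min/dᵢ`).  Product: `(U/d_min)^k · C(f)e^{−kγ} · ∏ᵢ d_min/dᵢ =
C(f)e^{−kγ}U^k/∏dᵢ`.  Factors with `p ≥ max zᵢ` equal `1`, which is why the inline product may run over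
all `p ≤ x`.  `k = 0`: `V = 1 = C(∅)`.  Honours `roughValueLaw_false_without_nonAssociated` /
`_irreducible` (both enter through `exists_polyRootCountMod_eq_sum` and `C(f) > 0`). -/
theorem stub_mertensAlongSystem :
    ∀ (k : ℕ) (f : Fin k → Polynomial ℤ), IsBatemanHornSystem f →
      ∀ U : ℝ, ((∑ i, (f i).natDegree : ℕ) : ℝ) ≤ U →
        Tendsto (fun x : ℕ =>
          (∏ p ∈ Nat.primesBelow (x + 1),
              (1 - (((range p).filter (fun r : ℕ => ∃ i,
                  (p : ℝ) < (x : ℝ) ^ (((f i).natDegree : ℝ) / U) ∧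
                    (p : ℤ) ∣ (f i).eval (r : ℤ))).card : ℝ) / (p : ℝ))) * Real.log x ^ k)
          atTop
          (𝓝 (batemanHornConst f / (∏ i, ((f i).natDegree : ℝ)) *
            Real.exp (-((k : ℝ) * Real.eulerMascheroniConstant)) * U ^ k)) := by
  sorry

-- `stub_omegaFacts`: LANDED (imported from the Theorems file; see module docstring).

-- `stub_ratioAnchoring`: LANDED (imported from the Theorems file; see module docstring).

/-- **S0 — `stub_linearRoughValueLaw`: the PROVABLE SECTOR of the open stubs (reshape 2, line
lead 2026-08-16; size L).**  For a single LINEAR polynomial `f = aX + b` (`k = 1`, `deg f = 1`;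
`a ≥ 1`, `(a,b) = 1` by `IsBatemanHornSystem`) and every inline-Buchstab `ω`, every rung of the crux
holds with the FORCED constant `A = C(f)/∏deg = C(aX+b) = a/φ(a)`:
`Φ_f(x,u)·(log x)/x → C(f)·uω(u)` for every `u > 2`.  This is Buchstab–de Bruijn in the arithmetic
progression `b mod a` ("rough numbers are equidistributed in the reduced classes"): with
`Y = ax + b`, `z = x^{1/u}`, `Φ_f(x,u) = #{1 ≤ m ≤ Y : m ≡ b (a), P⁻(m) ≥ z} + O(1)`
`= φ(a)⁻¹ ∑_χ χ̄(b) S_χ(Y,z) + O(1)` (orthogonality of Dirichlet characters mod `a`; rough `m` are prime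
to `a` once `z > a`), where `S_χ(Y,z) = ∑_{m ≤ Y, P⁻(m) ≥ z} χ(m)`; the principal character gives the
tree's PROVED integer law `Φ(Y,z) = ω(log Y/log z)·Y/log z + O(Y/log² z)`
(`exists_abs_card_roughIcc_sub_buchstab_le`, Lichtman Lemma 6.1), and for `χ ≠ χ₀`,
`S_χ(Y,z) = o(Y/log z)` by Buchstab's identity for completely multiplicative weights
(`S_χ(Y,z) = S_χ(Y,w) + ∑_{z ≤ p < w} χ(p) S_χ(Y/p,p)`) and induction on `⌈log Y/log z⌉` from the base
case `∑_{p ≤ t} χ(p) = o(t/log t)` = the tree's PROVED prime number theorem in progressions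
(`ParityWave0.tendsto_primeCountingMod_mul_log_div`, π-form, fixed modulus) summed against `χ`
(`∑_c χ(c) = 0`).  Finally `log Y/log z → u`, `ω` is continuous at `u` (it equals `buchstabOmega` on
`[1,∞)`: `OmegaFacts.eq_buchstabOmega`), and `C(aX+b) = a/φ(a)` (`batemanHornPartial_linear`,
translation invariance `batemanHornPartial_comp_X_add_C`).  The cases `f = X` (A = 1) and
`f = 2X+1` (A = 2) are cdisprove's `tendsto_ratio_X` / `conclusion_twoXAddOne`.  In the composition
below this stub settles the crux outright on the sector `k = 1 ∧ deg f₀ = 1`; everywhere else the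
open ratio laws S4/S5 are invoked (they remain TRUE on the linear sector, where S0 implies them). -/
theorem stub_linearRoughValueLaw :
    ∀ (k : ℕ) (f : Fin k → Polynomial ℤ), IsBatemanHornSystem f → k = 1 →
      (∀ i, (f i).natDegree = 1) → ∀ ω : ℝ → ℝ,
      ((∀ u : ℝ, 1 ≤ u → u ≤ 2 → ω u = u⁻¹) ∧ ContinuousOn ω (Set.Ici 1) ∧
        (∀ u : ℝ, 2 < u → HasDerivAt (fun t : ℝ => t * ω t) (ω (u - 1)) u)) →
      ∀ u : ℝ, 2 < u →
        Tendsto (fun x : ℕ =>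
          (((Icc 1 x).filter (fun n : ℕ => ∀ i, 0 < (f i).eval (n : ℤ) ∧
              ∀ p ∈ range ⌈(x : ℝ) ^ (((f i).natDegree : ℝ) / u)⌉₊,
                p.Prime → ¬ ((p : ℤ) ∣ (f i).eval (n : ℤ)))).card : ℝ) * Real.log x ^ k / (x : ℝ))
          atTop (𝓝 (batemanHornConst f / (∏ i, ((f i).natDegree : ℝ)) * (u * ω u) ^ k)) := by
  sorry

/-- **S4 — `stub_deepRatioLaw` (OPEN; the deep regime of the crux in scale-free form).**  For every
Bateman–Horn system, every inline-Buchstab `ω` and all depths `3 ≤ u < U`: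
`Φ_f(x,u)/Φ_f(x,U) → ((uω(u))/(Uω(U)))^k`.  Constant-free and existence-free: together with S1–S3
it is EQUIVALENT to the crux restricted to `u ≥ 3`, and it asserts nothing at depths `< 3` (so
nothing about prime or `E₂` values beyond what the rung `u = 3` contains).  The difference
`Φ_f(x,U) − Φ_f(x,u)` counts the `n` with some `fᵢ(n) = p₁·m`, `x^{dᵢ/U} ≤ p₁ < x^{dᵢ/u}`,
`p₁ ≤ x^{dᵢ/3}`: composite values with a built-in friable modulus — the regime the card calls
level-dominated (parity weight `κ[u,U] < 1`, e.g. `κ(3,4) = 0.467`, `κ(4,6) = 0.043`,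
`κ(6,10) ≈ 1.6·10⁻⁴`; level frontier for `n²+1`: friable/bilinear moduli to `x^{153/128}`,
needed `x^{2−ε}` — de la Bretèche–Drappeau doi:10.4171/jems/951, Merikoski arXiv:1908.08816 Prop. 4).
Why plausibly true: it is the Buchstab–de Bruijn law along `f` (the random model with the `e^γ`
correction built in); PROVED for `f = X` and `f = 2X+1` (`Disproof.lean: tendsto_ratio_X`,
`conclusion_twoXAddOne`), numerically reproduced to `10⁻³` at `u = 3, 4, 6, 10` for `X²+1`,
`(X,X+2)` (route CHEAPEST FALSIFIER, rattack j003265).  Why it might fail / why open: every fixed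
window is twist-sensitive (`Literature.Barriers.Parity.SelbergParityBarrier`, Bombieri's family
`A(uω(u) − cρ(u−1))`), so no Type-I/II argument proves it in degree `≥ 2`; an `f`-specific bias of
rough values refutes it.  Size: open problem (organising model for an attack: Harman's sieve on the
prime-indexed cofactor sequences with friable moduli + the Bombieri normal form; card §Transfer). -/
theorem stub_deepRatioLaw :
    ∀ (k : ℕ) (f : Fin k → Polynomial ℤ), IsBatemanHornSystem f → ∀ ω : ℝ → ℝ,
      ((∀ u : ℝ, 1 ≤ u → u ≤ 2 → ω u = u⁻¹) ∧ ContinuousOn ω (Set.Ici 1) ∧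
        (∀ u : ℝ, 2 < u → HasDerivAt (fun t : ℝ => t * ω t) (ω (u - 1)) u)) →
      ∀ u U : ℝ, 3 ≤ u → u < U →
        Tendsto (fun x : ℕ =>
          (((Icc 1 x).filter (fun n : ℕ => ∀ i, 0 < (f i).eval (n : ℤ) ∧
              ∀ p ∈ range ⌈(x : ℝ) ^ (((f i).natDegree : ℝ) / u)⌉₊,
                p.Prime → ¬ ((p : ℤ) ∣ (f i).eval (n : ℤ)))).card : ℝ) /
          (((Icc 1 x).filter (fun n : ℕ => ∀ i, 0 < (f i).eval (n : ℤ) ∧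
              ∀ p ∈ range ⌈(x : ℝ) ^ (((f i).natDegree : ℝ) / U)⌉₊,
                p.Prime → ¬ ((p : ℤ) ∣ (f i).eval (n : ℤ)))).card : ℝ)) atTop
          (𝓝 ((u * ω u / (U * ω U)) ^ k)) := by
  sorry

/-- **S5 — `stub_shallowRatioLaw` (OPEN, ω-FREE, constant-free; the boundary regime — HARDEST).**
For every Bateman–Horn system and every `2 < u < 3`:
`Φ_f(x,u)/Φ_f(x,3) → ((1 + log(u−1))/(1 + log 2))^k`.
Content: below depth `3` every counted value has `Ω(fᵢ(n)) ≤ 2` (`Disproof.lean: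
eventually_cardFactors_le_two`), so `Φ_f(x,3) − Φ_f(x,u)` counts `n` with a semiprime value
`fᵢ(n) = p₁p₂`, `x^{dᵢ/3} ≤ p₁ < x^{dᵢ/u}` in some coordinate: the stub is the SHAPE `log(u−1)` of
the `E₂` cells relative to the rung `u = 3`, with no constant and no claim that any limit of a
single count exists in absolute normalisation.  It does NOT imply the sibling crux
`BalancedSemiprimeLayer` nor Bateman–Horn for `f` (a balanced excess `E(x) ≍ x/(log x)^k` carried by
`p₁ ∈ [x^{dᵢ/2−o(1)}, x^{dᵢ/2}]` sits inside every `Φ_f(x,u)`, `u > 2` fixed, and is invisible to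
these ratios) — contrast triage r1-3 on `omega-class-shape-split`.  Why plausibly true: the
Buchstab shape on `(2,3]` (`uω(u) = 1 + log(u−1)`, `buchstabOmega_eq_of_mem_Icc_two_three`); PROVED
for `f = X` (`Disproof.lean: tendsto_ratio_X_explicit`) and `2X+1`; numerics: the finite-`x`
Hardy–Littlewood boundary-layer model reproduces the route's counts (`S(3)/P ≈ log 2 − 1.5/log x`,
triage r1-1/r1-3), so a refuter must compare against that model below `10¹²`, not against the limit.
Why it might fail / why hardest: `κ ≡ 1` on `(2,3)` — these windows are pure `E₂` cells along `f`,
fully parity-sensitive, with NO Type-II range for a thin polynomial sequence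
(`Literature.Barriers.Parity.FordMaynardLowLevel` applies verbatim); an `f`-specific Liouville bias of
rough values (`≠ ρ'(u)/ω(u)`) would refute it.  Size: open problem (BH-strength boundary regime). -/
theorem stub_shallowRatioLaw :
    ∀ (k : ℕ) (f : Fin k → Polynomial ℤ), IsBatemanHornSystem f →
      ∀ u : ℝ, 2 < u → u < 3 →
        Tendsto (fun x : ℕ =>
          (((Icc 1 x).filter (fun n : ℕ => ∀ i, 0 < (f i).eval (n : ℤ) ∧
              ∀ p ∈ range ⌈(x : ℝ) ^ (((f i).natDegree : ℝ) / u)⌉₊,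
                p.Prime → ¬ ((p : ℤ) ∣ (f i).eval (n : ℤ)))).card : ℝ) /
          (((Icc 1 x).filter (fun n : ℕ => ∀ i, 0 < (f i).eval (n : ℤ) ∧
              ∀ p ∈ range ⌈(x : ℝ) ^ (((f i).natDegree : ℝ) / 3)⌉₊,
                p.Prime → ¬ ((p : ℤ) ∣ (f i).eval (n : ℤ)))).card : ℝ)) atTop
          (𝓝 (((1 + Real.log (u - 1)) / (1 + Real.log 2)) ^ k)) := by
  sorry

/-! ## The composition (real proofs, no `sorry`) -/

/-- **Glue for reshape 1: S1a + S1b ⇒ the planner's `stub_sieveAnchor` statement, verbatim.**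
Positivity of `B(f) = (C(f)/∏deg fᵢ)e^{−kγ}` is the PROVED `hasBatemanHornConst_holds` (`C(f) > 0`)
and `IsBatemanHornSystem.natDegree_pos`; the band: with `ε₁ = min(ε,1)/3`, eventually
`Φ = xV(1 ± ε₁)` (S1a) and `V(log x)^k = BU^k(1 ± ε₁)` (S1b), and `(1 ± ε₁)² ∈ [1 − ε, 1 + ε]`. -/
theorem sieveAnchor_of_parts
    (hband : ∀ (k : ℕ) (f : Fin k → Polynomial ℤ), IsBatemanHornSystem f →
      ∀ ε : ℝ, 0 < ε → ∃ U₁ : ℝ, ∀ U : ℝ, U₁ ≤ U → ∀ᶠ x : ℕ in atTop,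
        |((((Icc 1 x).filter (fun n : ℕ => ∀ i, 0 < (f i).eval (n : ℤ) ∧
              ∀ p ∈ range ⌈(x : ℝ) ^ (((f i).natDegree : ℝ) / U)⌉₊,
                p.Prime → ¬ ((p : ℤ) ∣ (f i).eval (n : ℤ)))).card : ℝ) -
            (x : ℝ) * ∏ p ∈ Nat.primesBelow (x + 1),
              (1 - (((range p).filter (fun r : ℕ => ∃ i,
                  (p : ℝ) < (x : ℝ) ^ (((f i).natDegree : ℝ) / U) ∧
                    (p : ℤ) ∣ (f i).eval (r : ℤ))).card : ℝ) / (p : ℝ)))| ≤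
          ε * ((x : ℝ) * ∏ p ∈ Nat.primesBelow (x + 1),
              (1 - (((range p).filter (fun r : ℕ => ∃ i,
                  (p : ℝ) < (x : ℝ) ^ (((f i).natDegree : ℝ) / U) ∧
                    (p : ℤ) ∣ (f i).eval (r : ℤ))).card : ℝ) / (p : ℝ))))
    (hmert : ∀ (k : ℕ) (f : Fin k → Polynomial ℤ), IsBatemanHornSystem f →
      ∀ U : ℝ, ((∑ i, (f i).natDegree : ℕ) : ℝ) ≤ U →
        Tendsto (fun x : ℕ =>
          (∏ p ∈ Nat.primesBelow (x + 1),
              (1 - (((range p).filter (fun r : ℕ => ∃ i,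
                  (p : ℝ) < (x : ℝ) ^ (((f i).natDegree : ℝ) / U) ∧
                    (p : ℤ) ∣ (f i).eval (r : ℤ))).card : ℝ) / (p : ℝ))) * Real.log x ^ k)
          atTop
          (𝓝 (batemanHornConst f / (∏ i, ((f i).natDegree : ℝ)) *
            Real.exp (-((k : ℝ) * Real.eulerMascheroniConstant)) * U ^ k))) :
    ∀ (k : ℕ) (f : Fin k → Polynomial ℤ), IsBatemanHornSystem f →
      0 < batemanHornConst f / (∏ i, ((f i).natDegree : ℝ)) *
            Real.exp (-((k : ℝ) * Real.eulerMascheroniConstant)) ∧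
      ∀ ε : ℝ, 0 < ε → ∃ U₁ : ℝ, ∀ U : ℝ, U₁ ≤ U → ∀ᶠ x : ℕ in atTop,
        (1 - ε) * (batemanHornConst f / (∏ i, ((f i).natDegree : ℝ)) *
            Real.exp (-((k : ℝ) * Real.eulerMascheroniConstant)) * U ^ k) ≤
          (((Icc 1 x).filter (fun n : ℕ => ∀ i, 0 < (f i).eval (n : ℤ) ∧
              ∀ p ∈ range ⌈(x : ℝ) ^ (((f i).natDegree : ℝ) / U)⌉₊,
                p.Prime → ¬ ((p : ℤ) ∣ (f i).eval (n : ℤ)))).card : ℝ) * Real.log x ^ k / (x : ℝ) ∧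
        (((Icc 1 x).filter (fun n : ℕ => ∀ i, 0 < (f i).eval (n : ℤ) ∧
              ∀ p ∈ range ⌈(x : ℝ) ^ (((f i).natDegree : ℝ) / U)⌉₊,
                p.Prime → ¬ ((p : ℤ) ∣ (f i).eval (n : ℤ)))).card : ℝ) * Real.log x ^ k / (x : ℝ) ≤
          (1 + ε) * (batemanHornConst f / (∏ i, ((f i).natDegree : ℝ)) *
            Real.exp (-((k : ℝ) * Real.eulerMascheroniConstant)) * U ^ k) := by
  intro k f hf
  have hC : 0 < batemanHornConst f := (IsBatemanHornSystem.hasBatemanHornConst_holds hf).2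
  have hD : 0 < ∏ i, ((f i).natDegree : ℝ) :=
    Finset.prod_pos fun i _ => by exact_mod_cast hf.natDegree_pos i
  set B : ℝ := batemanHornConst f / (∏ i, ((f i).natDegree : ℝ)) *
      Real.exp (-((k : ℝ) * Real.eulerMascheroniConstant)) with hBdef
  have hB : 0 < B := mul_pos (div_pos hC hD) (Real.exp_pos _)
  refine ⟨hB, fun ε hε => ?_⟩
  set ε₁ : ℝ := min ε 1 / 3 with hε₁
  have hmin : 0 < min ε 1 := lt_min hε one_pos
  have hε₁pos : 0 < ε₁ := by rw [hε₁]; positivity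
  have hε₁le : 3 * ε₁ ≤ ε := by rw [hε₁]; linarith [min_le_left ε 1]
  have hε₁one : 3 * ε₁ ≤ 1 := by rw [hε₁]; linarith [min_le_right ε 1]
  obtain ⟨U₁, hU₁⟩ := hband k f hf ε₁ hε₁pos
  refine ⟨max U₁ (max (((∑ i, (f i).natDegree : ℕ) : ℝ)) 1), fun U hU => ?_⟩
  have hUU₁ : U₁ ≤ U := le_trans (le_max_left _ _) hU
  have hUdeg : (((∑ i, (f i).natDegree : ℕ) : ℝ)) ≤ U :=
    le_trans (le_trans (le_max_left _ _) (le_max_right _ _)) hU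
  have hU1 : (1 : ℝ) ≤ U := le_trans (le_trans (le_max_right _ _) (le_max_right _ _)) hU
  have hUpos : 0 < U := lt_of_lt_of_le one_pos hU1
  have hBU : 0 < B * U ^ k := mul_pos hB (pow_pos hUpos k)
  have h1 := hU₁ U hUU₁
  have h2 := hmert k f hf U hUdeg
  have h2' : ∀ᶠ x : ℕ in atTop,
      |(∏ p ∈ Nat.primesBelow (x + 1),
          (1 - (((range p).filter (fun r : ℕ => ∃ i,
              (p : ℝ) < (x : ℝ) ^ (((f i).natDegree : ℝ) / U) ∧
                (p : ℤ) ∣ (f i).eval (r : ℤ))).card : ℝ) / (p : ℝ))) * Real.log x ^ k -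
        B * U ^ k| ≤ ε₁ * (B * U ^ k) := by
    have hpos : 0 < ε₁ * (B * U ^ k) := mul_pos hε₁pos hBU
    filter_upwards [(Metric.tendsto_nhds.mp h2) (ε₁ * (B * U ^ k)) hpos] with x hx
    rw [Real.dist_eq] at hx
    exact hx.le
  have hx1 : ∀ᶠ x : ℕ in atTop, 1 ≤ x := eventually_ge_atTop 1
  filter_upwards [h1, h2', hx1] with x hR hV hx
  -- abbreviate
  set Φ : ℝ := (((Icc 1 x).filter (fun n : ℕ => ∀ i, 0 < (f i).eval (n : ℤ) ∧
      ∀ p ∈ range ⌈(x : ℝ) ^ (((f i).natDegree : ℝ) / U)⌉₊,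
        p.Prime → ¬ ((p : ℤ) ∣ (f i).eval (n : ℤ)))).card : ℝ) with hΦ
  set v : ℝ := ∏ p ∈ Nat.primesBelow (x + 1),
      (1 - (((range p).filter (fun r : ℕ => ∃ i,
          (p : ℝ) < (x : ℝ) ^ (((f i).natDegree : ℝ) / U) ∧
            (p : ℤ) ∣ (f i).eval (r : ℤ))).card : ℝ) / (p : ℝ)) with hv
  set L : ℝ := Real.log x ^ k with hL
  have hX : (0 : ℝ) < x := by exact_mod_cast hx
  have hL0 : 0 ≤ L := pow_nonneg (Real.log_nonneg (by exact_mod_cast hx)) k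
  -- from hV: (1 - ε₁) B U^k ≤ v L ≤ (1 + ε₁) B U^k, hence v L > 0, L > 0, v > 0
  have hV1 : (1 - ε₁) * (B * U ^ k) ≤ v * L := by
    have := (abs_le.mp hV).1; linarith
  have hV2 : v * L ≤ (1 + ε₁) * (B * U ^ k) := by
    have := (abs_le.mp hV).2; linarith
  have hvL : 0 < v * L := lt_of_lt_of_le (mul_pos (by linarith) hBU) hV1
  have hLpos : 0 < L := by
    rcases hL0.lt_or_eq with h | h
    · exact h
    · exfalso; rw [← h, mul_zero] at hvL; exact lt_irrefl _ hvL
  have hvpos : 0 < v := pos_of_mul_pos_left hvL hL0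
  have hxv : 0 < (x : ℝ) * v := mul_pos hX hvpos
  -- from hR: (1 - ε₁) x v ≤ Φ ≤ (1 + ε₁) x v
  have hR1 : (1 - ε₁) * ((x : ℝ) * v) ≤ Φ := by
    have := (abs_le.mp hR).1; linarith
  have hR2 : Φ ≤ (1 + ε₁) * ((x : ℝ) * v) := by
    have := (abs_le.mp hR).2; linarith
  -- Φ L / x = (Φ/(x v)) · (v L)
  have hkey : Φ * L / (x : ℝ) = Φ / ((x : ℝ) * v) * (v * L) := by
    field_simp
  rw [hkey]
  have hq1 : 1 - ε₁ ≤ Φ / ((x : ℝ) * v) := by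
    rw [le_div_iff₀ hxv]; exact hR1
  have hq2 : Φ / ((x : ℝ) * v) ≤ 1 + ε₁ := by
    rw [div_le_iff₀ hxv]; exact hR2
  have hq0 : 0 ≤ Φ / ((x : ℝ) * v) := le_trans (by linarith) hq1
  constructor
  · calc (1 - ε) * (B * U ^ k) ≤ (1 - ε₁) * ((1 - ε₁) * (B * U ^ k)) := by nlinarith
      _ ≤ Φ / ((x : ℝ) * v) * (v * L) :=
          mul_le_mul hq1 hV1 (le_of_lt (mul_pos (by linarith) hBU)) hq0
  · calc Φ / ((x : ℝ) * v) * (v * L) ≤ (1 + ε₁) * ((1 + ε₁) * (B * U ^ k)) :=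
          mul_le_mul hq2 hV2 hvL.le (by linarith)
      _ ≤ (1 + ε) * (B * U ^ k) := by nlinarith



/-- **Composition in hypothesis form** (the five stub STATEMENTS imply the crux BODY; clean axioms).
For `u ≥ 3`: S3 fed with S1, S2(b), S4.  For `2 < u < 3`: eventually
`Φ(x,u)ℓ_x = [Φ(x,3)ℓ_x]·[Φ(x,u)/Φ(x,3)]` (`Φ(x,3) ≠ 0` since its normalised limit is positive), the
limit is `B e^{kγ}(3ω(3))^k·((1+log(u−1))/(1+log 2))^k = B e^{kγ}(uω(u))^k` by S2(a). -/
theorem roughValueLaw_of_parts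
    (h₁ : ∀ (k : ℕ) (f : Fin k → Polynomial ℤ), IsBatemanHornSystem f →
      0 < batemanHornConst f / (∏ i, ((f i).natDegree : ℝ)) *
            Real.exp (-((k : ℝ) * Real.eulerMascheroniConstant)) ∧
      ∀ ε : ℝ, 0 < ε → ∃ U₁ : ℝ, ∀ U : ℝ, U₁ ≤ U → ∀ᶠ x : ℕ in atTop,
        (1 - ε) * (batemanHornConst f / (∏ i, ((f i).natDegree : ℝ)) *
            Real.exp (-((k : ℝ) * Real.eulerMascheroniConstant)) * U ^ k) ≤
          (((Icc 1 x).filter (fun n : ℕ => ∀ i, 0 < (f i).eval (n : ℤ) ∧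
              ∀ p ∈ range ⌈(x : ℝ) ^ (((f i).natDegree : ℝ) / U)⌉₊,
                p.Prime → ¬ ((p : ℤ) ∣ (f i).eval (n : ℤ)))).card : ℝ) * Real.log x ^ k / (x : ℝ) ∧
        (((Icc 1 x).filter (fun n : ℕ => ∀ i, 0 < (f i).eval (n : ℤ) ∧
              ∀ p ∈ range ⌈(x : ℝ) ^ (((f i).natDegree : ℝ) / U)⌉₊,
                p.Prime → ¬ ((p : ℤ) ∣ (f i).eval (n : ℤ)))).card : ℝ) * Real.log x ^ k / (x : ℝ) ≤
          (1 + ε) * (batemanHornConst f / (∏ i, ((f i).natDegree : ℝ)) *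
            Real.exp (-((k : ℝ) * Real.eulerMascheroniConstant)) * U ^ k))
    (h₂ : ∀ ω : ℝ → ℝ, ((∀ u : ℝ, 1 ≤ u → u ≤ 2 → ω u = u⁻¹) ∧ ContinuousOn ω (Set.Ici 1) ∧
        (∀ u : ℝ, 2 < u → HasDerivAt (fun t : ℝ => t * ω t) (ω (u - 1)) u)) →
      (∀ u : ℝ, 2 ≤ u → u ≤ 3 → u * ω u = 1 + Real.log (u - 1)) ∧
      Tendsto ω atTop (𝓝 (Real.exp (-Real.eulerMascheroniConstant))))
    (h₃ : ∀ (k : ℕ) (Φ : ℕ → ℝ → ℝ) (ω : ℝ → ℝ) (B u₀ : ℝ), 0 < B →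
      Tendsto ω atTop (𝓝 (Real.exp (-Real.eulerMascheroniConstant))) →
      (∀ ε : ℝ, 0 < ε → ∃ U₁ : ℝ, ∀ U : ℝ, U₁ ≤ U → ∀ᶠ x : ℕ in atTop,
        (1 - ε) * (B * U ^ k) ≤ Φ x U * Real.log x ^ k / (x : ℝ) ∧
          Φ x U * Real.log x ^ k / (x : ℝ) ≤ (1 + ε) * (B * U ^ k)) →
      (∀ u U : ℝ, u₀ ≤ u → u < U →
        Tendsto (fun x : ℕ => Φ x u / Φ x U) atTop (𝓝 ((u * ω u / (U * ω U)) ^ k))) →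
      ∀ u : ℝ, u₀ ≤ u →
        Tendsto (fun x : ℕ => Φ x u * Real.log x ^ k / (x : ℝ)) atTop
          (𝓝 (B * Real.exp ((k : ℝ) * Real.eulerMascheroniConstant) * (u * ω u) ^ k)))
    (h₄ : ∀ (k : ℕ) (f : Fin k → Polynomial ℤ), IsBatemanHornSystem f → ∀ ω : ℝ → ℝ,
      ((∀ u : ℝ, 1 ≤ u → u ≤ 2 → ω u = u⁻¹) ∧ ContinuousOn ω (Set.Ici 1) ∧
        (∀ u : ℝ, 2 < u → HasDerivAt (fun t : ℝ => t * ω t) (ω (u - 1)) u)) →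
      ∀ u U : ℝ, 3 ≤ u → u < U →
        Tendsto (fun x : ℕ =>
          (((Icc 1 x).filter (fun n : ℕ => ∀ i, 0 < (f i).eval (n : ℤ) ∧
              ∀ p ∈ range ⌈(x : ℝ) ^ (((f i).natDegree : ℝ) / u)⌉₊,
                p.Prime → ¬ ((p : ℤ) ∣ (f i).eval (n : ℤ)))).card : ℝ) /
          (((Icc 1 x).filter (fun n : ℕ => ∀ i, 0 < (f i).eval (n : ℤ) ∧
              ∀ p ∈ range ⌈(x : ℝ) ^ (((f i).natDegree : ℝ) / U)⌉₊,
                p.Prime → ¬ ((p : ℤ) ∣ (f i).eval (n : ℤ)))).card : ℝ)) atTop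
          (𝓝 ((u * ω u / (U * ω U)) ^ k)))
    (h₅ : ∀ (k : ℕ) (f : Fin k → Polynomial ℤ), IsBatemanHornSystem f →
      ∀ u : ℝ, 2 < u → u < 3 →
        Tendsto (fun x : ℕ =>
          (((Icc 1 x).filter (fun n : ℕ => ∀ i, 0 < (f i).eval (n : ℤ) ∧
              ∀ p ∈ range ⌈(x : ℝ) ^ (((f i).natDegree : ℝ) / u)⌉₊,
                p.Prime → ¬ ((p : ℤ) ∣ (f i).eval (n : ℤ)))).card : ℝ) /
          (((Icc 1 x).filter (fun n : ℕ => ∀ i, 0 < (f i).eval (n : ℤ) ∧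
              ∀ p ∈ range ⌈(x : ℝ) ^ (((f i).natDegree : ℝ) / 3)⌉₊,
                p.Prime → ¬ ((p : ℤ) ∣ (f i).eval (n : ℤ)))).card : ℝ)) atTop
          (𝓝 (((1 + Real.log (u - 1)) / (1 + Real.log 2)) ^ k))) :
    ∀ (k : ℕ) (f : Fin k → Polynomial ℤ), Literature.NumberTheory.Sieve.IsBatemanHornSystem f →
      ∀ ω : ℝ → ℝ, ((∀ u : ℝ, 1 ≤ u → u ≤ 2 → ω u = u⁻¹) ∧ ContinuousOn ω (Set.Ici 1) ∧
        (∀ u : ℝ, 2 < u → HasDerivAt (fun t : ℝ => t * ω t) (ω (u - 1)) u)) →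
      ∃ A : ℝ, ∀ u : ℝ, 2 < u → Filter.Tendsto (fun x : ℕ =>
        (((Finset.Icc 1 x).filter (fun n : ℕ => ∀ i, 0 < (f i).eval (n : ℤ) ∧
          ∀ p ∈ Finset.range ⌈(x : ℝ) ^ (((f i).natDegree : ℝ) / u)⌉₊,
            p.Prime → ¬ ((p : ℤ) ∣ (f i).eval (n : ℤ)))).card : ℝ) * Real.log x ^ k / (x : ℝ))
        Filter.atTop (nhds (A * (u * ω u) ^ k)) := by
  intro k f hf ω hω
  obtain ⟨hB, hband⟩ := h₁ k f hf
  obtain ⟨h23, hlim⟩ := h₂ ω hω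
  -- the rungs `u ≥ 3`: the transfer stub fed with S1, S2(b), S4
  have hdeep := h₃ k (fun (x : ℕ) (u : ℝ) =>
      (((Icc 1 x).filter (fun n : ℕ => ∀ i, 0 < (f i).eval (n : ℤ) ∧
        ∀ p ∈ range ⌈(x : ℝ) ^ (((f i).natDegree : ℝ) / u)⌉₊,
          p.Prime → ¬ ((p : ℤ) ∣ (f i).eval (n : ℤ)))).card : ℝ)) ω _ 3 hB hlim hband (h₄ k f hf ω hω)
  refine ⟨batemanHornConst f / (∏ i, ((f i).natDegree : ℝ)) *
      Real.exp (-((k : ℝ) * Real.eulerMascheroniConstant)) *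
      Real.exp ((k : ℝ) * Real.eulerMascheroniConstant), fun u hu => ?_⟩
  by_cases h3u : 3 ≤ u
  · exact hdeep u h3u
  · have h3u : u < 3 := not_le.mp h3u
    have hthree := hdeep 3 le_rfl
    have hrat := h₅ k f hf u hu h3u
    have h3ω : (3 : ℝ) * ω 3 = 1 + Real.log 2 := by
      have h := h23 3 (by norm_num) le_rfl
      rwa [show (3 : ℝ) - 1 = 2 by norm_num] at h
    have huω : u * ω u = 1 + Real.log (u - 1) := h23 u hu.le h3u.le
    have hlog2 : 0 < 1 + Real.log 2 := by
      have := Real.log_pos (by norm_num : (1 : ℝ) < 2)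
      linarith
    have hL3pos : 0 < batemanHornConst f / (∏ i, ((f i).natDegree : ℝ)) *
        Real.exp (-((k : ℝ) * Real.eulerMascheroniConstant)) *
        Real.exp ((k : ℝ) * Real.eulerMascheroniConstant) * ((3 : ℝ) * ω 3) ^ k := by
      rw [h3ω]
      exact mul_pos (mul_pos hB (Real.exp_pos _)) (pow_pos hlog2 k)
    -- eventually the rung-3 count is nonzero
    have hne : ∀ᶠ x : ℕ in atTop,
        (((Icc 1 x).filter (fun n : ℕ => ∀ i, 0 < (f i).eval (n : ℤ) ∧
          ∀ p ∈ range ⌈(x : ℝ) ^ (((f i).natDegree : ℝ) / 3)⌉₊,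
            p.Prime → ¬ ((p : ℤ) ∣ (f i).eval (n : ℤ)))).card : ℝ) ≠ 0 := by
      have hev := hthree.eventually (lt_mem_nhds hL3pos)
      filter_upwards [hev] with x hx
      intro h0
      beta_reduce at hx
      rw [h0, zero_mul, zero_div] at hx
      exact lt_irrefl _ hx
    have hprod := hthree.mul hrat
    have key : Tendsto (fun x : ℕ =>
        (((Icc 1 x).filter (fun n : ℕ => ∀ i, 0 < (f i).eval (n : ℤ) ∧
          ∀ p ∈ range ⌈(x : ℝ) ^ (((f i).natDegree : ℝ) / u)⌉₊,
            p.Prime → ¬ ((p : ℤ) ∣ (f i).eval (n : ℤ)))).card : ℝ) * Real.log x ^ k / (x : ℝ))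
        atTop (𝓝 (batemanHornConst f / (∏ i, ((f i).natDegree : ℝ)) *
          Real.exp (-((k : ℝ) * Real.eulerMascheroniConstant)) *
          Real.exp ((k : ℝ) * Real.eulerMascheroniConstant) * ((3 : ℝ) * ω 3) ^ k *
          (((1 + Real.log (u - 1)) / (1 + Real.log 2)) ^ k))) := by
      refine hprod.congr' ?_
      filter_upwards [hne] with x hx
      beta_reduce
      calc (((Icc 1 x).filter (fun n : ℕ => ∀ i, 0 < (f i).eval (n : ℤ) ∧
              ∀ p ∈ range ⌈(x : ℝ) ^ (((f i).natDegree : ℝ) / 3)⌉₊,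
                p.Prime → ¬ ((p : ℤ) ∣ (f i).eval (n : ℤ)))).card : ℝ) * Real.log x ^ k / (x : ℝ) *
            ((((Icc 1 x).filter (fun n : ℕ => ∀ i, 0 < (f i).eval (n : ℤ) ∧
              ∀ p ∈ range ⌈(x : ℝ) ^ (((f i).natDegree : ℝ) / u)⌉₊,
                p.Prime → ¬ ((p : ℤ) ∣ (f i).eval (n : ℤ)))).card : ℝ) /
            (((Icc 1 x).filter (fun n : ℕ => ∀ i, 0 < (f i).eval (n : ℤ) ∧
              ∀ p ∈ range ⌈(x : ℝ) ^ (((f i).natDegree : ℝ) / 3)⌉₊,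
                p.Prime → ¬ ((p : ℤ) ∣ (f i).eval (n : ℤ)))).card : ℝ))
          = ((((Icc 1 x).filter (fun n : ℕ => ∀ i, 0 < (f i).eval (n : ℤ) ∧
              ∀ p ∈ range ⌈(x : ℝ) ^ (((f i).natDegree : ℝ) / 3)⌉₊,
                p.Prime → ¬ ((p : ℤ) ∣ (f i).eval (n : ℤ)))).card : ℝ) /
            (((Icc 1 x).filter (fun n : ℕ => ∀ i, 0 < (f i).eval (n : ℤ) ∧
              ∀ p ∈ range ⌈(x : ℝ) ^ (((f i).natDegree : ℝ) / 3)⌉₊,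
                p.Prime → ¬ ((p : ℤ) ∣ (f i).eval (n : ℤ)))).card : ℝ)) *
            ((((Icc 1 x).filter (fun n : ℕ => ∀ i, 0 < (f i).eval (n : ℤ) ∧
              ∀ p ∈ range ⌈(x : ℝ) ^ (((f i).natDegree : ℝ) / u)⌉₊,
                p.Prime → ¬ ((p : ℤ) ∣ (f i).eval (n : ℤ)))).card : ℝ) * Real.log x ^ k / (x : ℝ)) := by
            ring
        _ = (((Icc 1 x).filter (fun n : ℕ => ∀ i, 0 < (f i).eval (n : ℤ) ∧
              ∀ p ∈ range ⌈(x : ℝ) ^ (((f i).natDegree : ℝ) / u)⌉₊,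
                p.Prime → ¬ ((p : ℤ) ∣ (f i).eval (n : ℤ)))).card : ℝ) * Real.log x ^ k / (x : ℝ) := by
            rw [div_self hx, one_mul]
    have hV : batemanHornConst f / (∏ i, ((f i).natDegree : ℝ)) *
          Real.exp (-((k : ℝ) * Real.eulerMascheroniConstant)) *
          Real.exp ((k : ℝ) * Real.eulerMascheroniConstant) * ((3 : ℝ) * ω 3) ^ k *
          (((1 + Real.log (u - 1)) / (1 + Real.log 2)) ^ k) =
        batemanHornConst f / (∏ i, ((f i).natDegree : ℝ)) *
          Real.exp (-((k : ℝ) * Real.eulerMascheroniConstant)) *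
          Real.exp ((k : ℝ) * Real.eulerMascheroniConstant) * (u * ω u) ^ k := by
      have hne2 : (1 + Real.log 2) ^ k ≠ 0 := pow_ne_zero k hlog2.ne'
      rw [h3ω, huω, div_pow, mul_assoc _ ((1 + Real.log 2) ^ k), mul_div_cancel₀ _ hne2]
    rw [hV] at key
    exact key

/-- **Composition with the linear sector split off (reshape 2).**  On the sector
`k = 1 ∧ ∀ i, deg fᵢ = 1` the crux is S0 with `A := C(f)/∏deg`; elsewhere it is
`roughValueLaw_of_parts` (S1–S5).  Real proof. -/
theorem roughValueLaw_of_parts'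
    (h₀ : ∀ (k : ℕ) (f : Fin k → Polynomial ℤ), IsBatemanHornSystem f → k = 1 →
      (∀ i, (f i).natDegree = 1) → ∀ ω : ℝ → ℝ,
      ((∀ u : ℝ, 1 ≤ u → u ≤ 2 → ω u = u⁻¹) ∧ ContinuousOn ω (Set.Ici 1) ∧
        (∀ u : ℝ, 2 < u → HasDerivAt (fun t : ℝ => t * ω t) (ω (u - 1)) u)) →
      ∀ u : ℝ, 2 < u →
        Tendsto (fun x : ℕ =>
          (((Icc 1 x).filter (fun n : ℕ => ∀ i, 0 < (f i).eval (n : ℤ) ∧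
              ∀ p ∈ range ⌈(x : ℝ) ^ (((f i).natDegree : ℝ) / u)⌉₊,
                p.Prime → ¬ ((p : ℤ) ∣ (f i).eval (n : ℤ)))).card : ℝ) * Real.log x ^ k / (x : ℝ))
          atTop (𝓝 (batemanHornConst f / (∏ i, ((f i).natDegree : ℝ)) * (u * ω u) ^ k)))
    (h₁ : ∀ (k : ℕ) (f : Fin k → Polynomial ℤ), IsBatemanHornSystem f →
      0 < batemanHornConst f / (∏ i, ((f i).natDegree : ℝ)) *
            Real.exp (-((k : ℝ) * Real.eulerMascheroniConstant)) ∧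
      ∀ ε : ℝ, 0 < ε → ∃ U₁ : ℝ, ∀ U : ℝ, U₁ ≤ U → ∀ᶠ x : ℕ in atTop,
        (1 - ε) * (batemanHornConst f / (∏ i, ((f i).natDegree : ℝ)) *
            Real.exp (-((k : ℝ) * Real.eulerMascheroniConstant)) * U ^ k) ≤
          (((Icc 1 x).filter (fun n : ℕ => ∀ i, 0 < (f i).eval (n : ℤ) ∧
              ∀ p ∈ range ⌈(x : ℝ) ^ (((f i).natDegree : ℝ) / U)⌉₊,
                p.Prime → ¬ ((p : ℤ) ∣ (f i).eval (n : ℤ)))).card : ℝ) * Real.log x ^ k / (x : ℝ) ∧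
        (((Icc 1 x).filter (fun n : ℕ => ∀ i, 0 < (f i).eval (n : ℤ) ∧
              ∀ p ∈ range ⌈(x : ℝ) ^ (((f i).natDegree : ℝ) / U)⌉₊,
                p.Prime → ¬ ((p : ℤ) ∣ (f i).eval (n : ℤ)))).card : ℝ) * Real.log x ^ k / (x : ℝ) ≤
          (1 + ε) * (batemanHornConst f / (∏ i, ((f i).natDegree : ℝ)) *
            Real.exp (-((k : ℝ) * Real.eulerMascheroniConstant)) * U ^ k))
    (h₂ : ∀ ω : ℝ → ℝ, ((∀ u : ℝ, 1 ≤ u → u ≤ 2 → ω u = u⁻¹) ∧ ContinuousOn ω (Set.Ici 1) ∧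
        (∀ u : ℝ, 2 < u → HasDerivAt (fun t : ℝ => t * ω t) (ω (u - 1)) u)) →
      (∀ u : ℝ, 2 ≤ u → u ≤ 3 → u * ω u = 1 + Real.log (u - 1)) ∧
      Tendsto ω atTop (𝓝 (Real.exp (-Real.eulerMascheroniConstant))))
    (h₃ : ∀ (k : ℕ) (Φ : ℕ → ℝ → ℝ) (ω : ℝ → ℝ) (B u₀ : ℝ), 0 < B →
      Tendsto ω atTop (𝓝 (Real.exp (-Real.eulerMascheroniConstant))) →
      (∀ ε : ℝ, 0 < ε → ∃ U₁ : ℝ, ∀ U : ℝ, U₁ ≤ U → ∀ᶠ x : ℕ in atTop,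
        (1 - ε) * (B * U ^ k) ≤ Φ x U * Real.log x ^ k / (x : ℝ) ∧
          Φ x U * Real.log x ^ k / (x : ℝ) ≤ (1 + ε) * (B * U ^ k)) →
      (∀ u U : ℝ, u₀ ≤ u → u < U →
        Tendsto (fun x : ℕ => Φ x u / Φ x U) atTop (𝓝 ((u * ω u / (U * ω U)) ^ k))) →
      ∀ u : ℝ, u₀ ≤ u →
        Tendsto (fun x : ℕ => Φ x u * Real.log x ^ k / (x : ℝ)) atTop
          (𝓝 (B * Real.exp ((k : ℝ) * Real.eulerMascheroniConstant) * (u * ω u) ^ k)))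
    (h₄ : ∀ (k : ℕ) (f : Fin k → Polynomial ℤ), IsBatemanHornSystem f → ∀ ω : ℝ → ℝ,
      ((∀ u : ℝ, 1 ≤ u → u ≤ 2 → ω u = u⁻¹) ∧ ContinuousOn ω (Set.Ici 1) ∧
        (∀ u : ℝ, 2 < u → HasDerivAt (fun t : ℝ => t * ω t) (ω (u - 1)) u)) →
      ∀ u U : ℝ, 3 ≤ u → u < U →
        Tendsto (fun x : ℕ =>
          (((Icc 1 x).filter (fun n : ℕ => ∀ i, 0 < (f i).eval (n : ℤ) ∧
              ∀ p ∈ range ⌈(x : ℝ) ^ (((f i).natDegree : ℝ) / u)⌉₊,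
                p.Prime → ¬ ((p : ℤ) ∣ (f i).eval (n : ℤ)))).card : ℝ) /
          (((Icc 1 x).filter (fun n : ℕ => ∀ i, 0 < (f i).eval (n : ℤ) ∧
              ∀ p ∈ range ⌈(x : ℝ) ^ (((f i).natDegree : ℝ) / U)⌉₊,
                p.Prime → ¬ ((p : ℤ) ∣ (f i).eval (n : ℤ)))).card : ℝ)) atTop
          (𝓝 ((u * ω u / (U * ω U)) ^ k)))
    (h₅ : ∀ (k : ℕ) (f : Fin k → Polynomial ℤ), IsBatemanHornSystem f →
      ∀ u : ℝ, 2 < u → u < 3 →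
        Tendsto (fun x : ℕ =>
          (((Icc 1 x).filter (fun n : ℕ => ∀ i, 0 < (f i).eval (n : ℤ) ∧
              ∀ p ∈ range ⌈(x : ℝ) ^ (((f i).natDegree : ℝ) / u)⌉₊,
                p.Prime → ¬ ((p : ℤ) ∣ (f i).eval (n : ℤ)))).card : ℝ) /
          (((Icc 1 x).filter (fun n : ℕ => ∀ i, 0 < (f i).eval (n : ℤ) ∧
              ∀ p ∈ range ⌈(x : ℝ) ^ (((f i).natDegree : ℝ) / 3)⌉₊,
                p.Prime → ¬ ((p : ℤ) ∣ (f i).eval (n : ℤ)))).card : ℝ)) atTop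
          (𝓝 (((1 + Real.log (u - 1)) / (1 + Real.log 2)) ^ k))) :
    ∀ (k : ℕ) (f : Fin k → Polynomial ℤ), Literature.NumberTheory.Sieve.IsBatemanHornSystem f →
      ∀ ω : ℝ → ℝ, ((∀ u : ℝ, 1 ≤ u → u ≤ 2 → ω u = u⁻¹) ∧ ContinuousOn ω (Set.Ici 1) ∧
        (∀ u : ℝ, 2 < u → HasDerivAt (fun t : ℝ => t * ω t) (ω (u - 1)) u)) →
      ∃ A : ℝ, ∀ u : ℝ, 2 < u → Filter.Tendsto (fun x : ℕ =>
        (((Finset.Icc 1 x).filter (fun n : ℕ => ∀ i, 0 < (f i).eval (n : ℤ) ∧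
          ∀ p ∈ Finset.range ⌈(x : ℝ) ^ (((f i).natDegree : ℝ) / u)⌉₊,
            p.Prime → ¬ ((p : ℤ) ∣ (f i).eval (n : ℤ)))).card : ℝ) * Real.log x ^ k / (x : ℝ))
        Filter.atTop (nhds (A * (u * ω u) ^ k)) := by
  intro k f hf ω hω
  by_cases hlin : k = 1 ∧ ∀ i, (f i).natDegree = 1
  · exact ⟨batemanHornConst f / (∏ i, ((f i).natDegree : ℝ)),
      fun u hu => h₀ k f hf hlin.1 hlin.2 ω hω u hu⟩
  · exact roughValueLaw_of_parts h₁ h₂ h₃ h₄ h₅ k f hf ω hω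

/-- **Converse normal form (real proof, documentation for the hand-back): the crux implies the two
open ratio laws S4 ∧ S5.**  Given the crux, fix `f`, `ω`; the landed calibration
(`sieveAnchor_of_parts stub_sieveBand stub_mertensAlongSystem`: band with `B(f) > 0` at a large
depth `U₀`) forces `A·(U₀ω(U₀))^k ≥ (1−½)B U₀^k > 0`, so `A ≠ 0`; `Vω(V) > 0` for every `V > 2`
because `ω = buchstabOmega ≥ ½` on `[1,∞)` (`OmegaFacts.eq_buchstabOmega`, `half_le_buchstabOmega`);
hence the ratio of two rungs converges to the ratio of their limits, which is S4, and with
`uω(u) = 1 + log(u−1)` on `[2,3]` (`stub_omegaFacts`) it is S5.  Together with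
`roughValueLaw_of_parts` this shows S4 ∧ S5 ≡ crux modulo the four LANDED service stubs: the open
stubs are the crux in projective (constant-free, existence-free) coordinates, split at `u = 3`. -/
theorem ratioLaws_of_roughValueLaw
    (hcrux : ∀ (k : ℕ) (f : Fin k → Polynomial ℤ), IsBatemanHornSystem f →
      ∀ ω : ℝ → ℝ, ((∀ u : ℝ, 1 ≤ u → u ≤ 2 → ω u = u⁻¹) ∧ ContinuousOn ω (Set.Ici 1) ∧
        (∀ u : ℝ, 2 < u → HasDerivAt (fun t : ℝ => t * ω t) (ω (u - 1)) u)) →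
      ∃ A : ℝ, ∀ u : ℝ, 2 < u → Tendsto (fun x : ℕ =>
        (((Icc 1 x).filter (fun n : ℕ => ∀ i, 0 < (f i).eval (n : ℤ) ∧
          ∀ p ∈ range ⌈(x : ℝ) ^ (((f i).natDegree : ℝ) / u)⌉₊,
            p.Prime → ¬ ((p : ℤ) ∣ (f i).eval (n : ℤ)))).card : ℝ) * Real.log x ^ k / (x : ℝ))
        atTop (𝓝 (A * (u * ω u) ^ k))) :
    (∀ (k : ℕ) (f : Fin k → Polynomial ℤ), IsBatemanHornSystem f → ∀ ω : ℝ → ℝ,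
      ((∀ u : ℝ, 1 ≤ u → u ≤ 2 → ω u = u⁻¹) ∧ ContinuousOn ω (Set.Ici 1) ∧
        (∀ u : ℝ, 2 < u → HasDerivAt (fun t : ℝ => t * ω t) (ω (u - 1)) u)) →
      ∀ u U : ℝ, 3 ≤ u → u < U →
        Tendsto (fun x : ℕ =>
          (((Icc 1 x).filter (fun n : ℕ => ∀ i, 0 < (f i).eval (n : ℤ) ∧
              ∀ p ∈ range ⌈(x : ℝ) ^ (((f i).natDegree : ℝ) / u)⌉₊,
                p.Prime → ¬ ((p : ℤ) ∣ (f i).eval (n : ℤ)))).card : ℝ) /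
          (((Icc 1 x).filter (fun n : ℕ => ∀ i, 0 < (f i).eval (n : ℤ) ∧
              ∀ p ∈ range ⌈(x : ℝ) ^ (((f i).natDegree : ℝ) / U)⌉₊,
                p.Prime → ¬ ((p : ℤ) ∣ (f i).eval (n : ℤ)))).card : ℝ)) atTop
          (𝓝 ((u * ω u / (U * ω U)) ^ k))) ∧
    (∀ (k : ℕ) (f : Fin k → Polynomial ℤ), IsBatemanHornSystem f →
      ∀ u : ℝ, 2 < u → u < 3 →
        Tendsto (fun x : ℕ =>
          (((Icc 1 x).filter (fun n : ℕ => ∀ i, 0 < (f i).eval (n : ℤ) ∧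
              ∀ p ∈ range ⌈(x : ℝ) ^ (((f i).natDegree : ℝ) / u)⌉₊,
                p.Prime → ¬ ((p : ℤ) ∣ (f i).eval (n : ℤ)))).card : ℝ) /
          (((Icc 1 x).filter (fun n : ℕ => ∀ i, 0 < (f i).eval (n : ℤ) ∧
              ∀ p ∈ range ⌈(x : ℝ) ^ (((f i).natDegree : ℝ) / 3)⌉₊,
                p.Prime → ¬ ((p : ℤ) ∣ (f i).eval (n : ℤ)))).card : ℝ)) atTop
          (𝓝 (((1 + Real.log (u - 1)) / (1 + Real.log 2)) ^ k))) := by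
  -- the common core: ratios of two rungs converge to ratios of their limits
  have core : ∀ (k : ℕ) (f : Fin k → Polynomial ℤ), IsBatemanHornSystem f → ∀ ω : ℝ → ℝ,
      ((∀ u : ℝ, 1 ≤ u → u ≤ 2 → ω u = u⁻¹) ∧ ContinuousOn ω (Set.Ici 1) ∧
        (∀ u : ℝ, 2 < u → HasDerivAt (fun t : ℝ => t * ω t) (ω (u - 1)) u)) →
      ∀ u U : ℝ, 2 < u → 2 < U →
        Tendsto (fun x : ℕ =>
          (((Icc 1 x).filter (fun n : ℕ => ∀ i, 0 < (f i).eval (n : ℤ) ∧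
              ∀ p ∈ range ⌈(x : ℝ) ^ (((f i).natDegree : ℝ) / u)⌉₊,
                p.Prime → ¬ ((p : ℤ) ∣ (f i).eval (n : ℤ)))).card : ℝ) /
          (((Icc 1 x).filter (fun n : ℕ => ∀ i, 0 < (f i).eval (n : ℤ) ∧
              ∀ p ∈ range ⌈(x : ℝ) ^ (((f i).natDegree : ℝ) / U)⌉₊,
                p.Prime → ¬ ((p : ℤ) ∣ (f i).eval (n : ℤ)))).card : ℝ)) atTop
          (𝓝 ((u * ω u) ^ k / (U * ω U) ^ k)) := by
    intro k f hf ω hω u U hu hU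
    obtain ⟨A, hA⟩ := hcrux k f hf ω hω
    -- `Vω(V) > 0` for `V > 2`
    have hpos : ∀ V : ℝ, 2 < V → 0 < V * ω V := by
      intro V hV
      have h1 : (1 : ℝ) ≤ V := by linarith
      rw [OmegaFacts.eq_buchstabOmega hω.1 hω.2.1 hω.2.2 h1]
      exact mul_pos (by linarith) (lt_of_lt_of_le (by norm_num) (half_le_buchstabOmega h1))
    -- `A > 0` from the landed calibration band at a large depth
    obtain ⟨hB, hband⟩ := sieveAnchor_of_parts stub_sieveBand stub_mertensAlongSystem k f hf
    obtain ⟨U₁, hU₁⟩ := hband (1 / 2) (by norm_num)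
    set U₀ : ℝ := max U₁ 3 with hU₀
    have hU₀2 : (2 : ℝ) < U₀ := lt_of_lt_of_le (by norm_num) (le_max_right _ _)
    have hlim₀ := hA U₀ hU₀2
    have hev := hU₁ U₀ (le_max_left _ _)
    have hle : (1 - 1 / 2) * (batemanHornConst f / (∏ i, ((f i).natDegree : ℝ)) *
        Real.exp (-((k : ℝ) * Real.eulerMascheroniConstant)) * U₀ ^ k) ≤ A * (U₀ * ω U₀) ^ k :=
      ge_of_tendsto hlim₀ (hev.mono fun x hx => hx.1)
    have hBU : 0 < batemanHornConst f / (∏ i, ((f i).natDegree : ℝ)) *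
        Real.exp (-((k : ℝ) * Real.eulerMascheroniConstant)) * U₀ ^ k :=
      mul_pos hB (pow_pos (by linarith) k)
    have hAU : 0 < A * (U₀ * ω U₀) ^ k := lt_of_lt_of_le (by linarith) hle
    have hApos : 0 < A := pos_of_mul_pos_left hAU (pow_nonneg (hpos U₀ hU₀2).le k)
    -- ratio of the two rungs
    have hne : A * (U * ω U) ^ k ≠ 0 := (mul_pos hApos (pow_pos (hpos U hU) k)).ne'
    have hdiv := (hA u hu).div (hA U hU) hne
    have heq : A * (u * ω u) ^ k / (A * (U * ω U) ^ k) = (u * ω u) ^ k / (U * ω U) ^ k :=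
      mul_div_mul_left _ _ hApos.ne'
    rw [heq] at hdiv
    refine hdiv.congr' ?_
    filter_upwards [eventually_ge_atTop 2] with x hx
    have hX : (x : ℝ) ≠ 0 := by positivity
    have hL : Real.log x ^ k ≠ 0 := pow_ne_zero k (Real.log_pos (by exact_mod_cast hx)).ne'
    rw [Pi.div_apply, div_div_div_cancel_right₀ hX, mul_div_mul_right _ _ hL]
  refine ⟨fun k f hf ω hω u U hu huU => ?_, fun k f hf u hu2 hu3 => ?_⟩
  · have h := core k f hf ω hω u U (by linarith) (by linarith)
    rwa [← div_pow] at h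
  · -- instantiate at `ω := buchstabOmega` (the crux quantifies over every Buchstab `ω`)
    have hω : (∀ u : ℝ, 1 ≤ u → u ≤ 2 → buchstabOmega u = u⁻¹) ∧
        ContinuousOn buchstabOmega (Set.Ici 1) ∧
        (∀ u : ℝ, 2 < u →
          HasDerivAt (fun t : ℝ => t * buchstabOmega t) (buchstabOmega (u - 1)) u) :=
      ⟨fun u h1 h2 => buchstabOmega_eq_inv h1 h2, continuousOn_buchstabOmega,
        fun u hu => hasDerivAt_mul_buchstabOmega hu⟩
    have h := core k f hf buchstabOmega hω u 3 hu2 (by norm_num)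
    obtain ⟨h23, -⟩ := stub_omegaFacts buchstabOmega hω
    have hu' : u * buchstabOmega u = 1 + Real.log (u - 1) := h23 u hu2.le hu3.le
    have h3 : (3 : ℝ) * buchstabOmega 3 = 1 + Real.log 2 := by
      have := h23 3 (by norm_num) le_rfl
      rwa [show (3 : ℝ) - 1 = 2 by norm_num] at this
    rwa [hu', h3, ← div_pow] at h

/-- **The line concludes the crux BY NAME** (the `#h21_check_skeleton` theorem): the five registered
stubs, fed to `roughValueLaw_of_parts`, give
`Summit.Parity.BatemanHorn.Theses.RoughValueTransport.RoughValueLaw`.  No `sorry` of its own; its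
axiom closure contains `sorryAx` exactly through the `stub_*`. -/
theorem RoughValueLaw_of : RoughValueLaw :=
  roughValueLaw_of_parts' stub_linearRoughValueLaw
    (sieveAnchor_of_parts stub_sieveBand stub_mertensAlongSystem) stub_omegaFacts
    stub_ratioAnchoring stub_deepRatioLaw stub_shallowRatioLaw

end Summit.Parity.BatemanHorn.Cruxes.RoughValueLaw.IncrementAnchoring
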